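import Literature.AlgebraicGeometry.Motives.GrassmannianChartSchemePointsLemmas
import HarnessLib

/-!
# Points of the chart scheme: `(T ⟶ Spec ℤ[X_p]) ≃ ({j // j ∉ range I} × Fin k → Γ(T, ⊤))` (objects)

Topic `Literature/AlgebraicGeometry/Motives`; namespace `Literature.AlgebraicGeometry.Motives.Grassmannian`.  (A3.1) of the (h4) interface
memo, cell hodgecm-mathlib (B-p18 (g17)): the functor of points of the chart scheme `chartScheme k I = Spec ℤ[X_p]` is the affine space
`T ↦ (σ_I × Fin k → Γ(T, ⊤))`, naturally in `T` — Mathlib `AffineSpace.toSpecMvPolyIntEquiv` re-done for `ℤ` coefficients with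
variables in `Type u`.  DEFINITION (term-mode; the two inverse laws are the PROOF-lane lemmas of `GrassmannianChartSchemePointsLemmas`)
+ `rfl` lemmas (statement-only lane).  No instance / notation / `sorry`.

* **`toChartSchemeEquiv k I : (T ⟶ chartScheme k I) ≃ ({j // j ∉ Set.range I} × Fin k → Γ(T, ⊤))`**, `g ↦ (g^*(X_p))_p`,
  inverse `v ↦ T.toSpecΓ ≫ Spec (X_p ↦ v p)`;
* `toChartSchemeEquiv_apply`, `toChartSchemeEquiv_symm_apply`, and NATURALITY `toChartSchemeEquiv_comp` (all `rfl`).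

[Stacks 089T]; EGA I (1971) 9.7.4.  HC_CM is proved only modulo the 7 printed citations until rung 0 closes; nothing here is about HC.
-/

noncomputable section

namespace Literature.AlgebraicGeometry.Motives.Grassmannian

open CategoryTheory Opposite TensorProduct _root_.AlgebraicGeometry

universe u

variable (k : ℕ) {J : Type u}

/-- **The functor of points of the chart scheme**: morphisms `T ⟶ Spec ℤ[X_p]` are families of global sections indexed by the
variables (`g ↦ (g^*(X_p))_p`; inverse `v ↦ (T → Spec Γ(T, ⊤) → Spec ℤ[X_p])`). [cite: StacksProject, Tag 089T] -/
def toChartSchemeEquiv (I : Fin k → J) {T : Scheme.{u}} :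
    (T ⟶ chartScheme k I) ≃ ({j : J // j ∉ Set.range I} × Fin k → Γ(T, ⊤)) where
  toFun g p := g.appTop ((Scheme.ΓSpecIso (chartRing k I)).inv (chartVar k I p))
  invFun v := T.toSpecΓ ≫ Spec.map (chartRingHom k I v)
  left_inv g := toSpecΓ_specMap_chartRingHom_appTop k I g
  right_inv v := funext fun p => appTop_toSpecΓ_specMap_chartRingHom k I v p

/-- `toChartSchemeEquiv g p = g^*(X_p)`. [cite: StacksProject, Tag 089T] -/
theorem toChartSchemeEquiv_apply (I : Fin k → J) {T : Scheme.{u}} (g : T ⟶ chartScheme k I) (p : {j : J // j ∉ Set.range I} × Fin k) :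
    toChartSchemeEquiv k I g p = g.appTop ((Scheme.ΓSpecIso (chartRing k I)).inv (chartVar k I p)) :=
  rfl

/-- The inverse: `v ↦ T.toSpecΓ ≫ Spec (X_p ↦ v p)`. [cite: StacksProject, Tag 089T] -/
theorem toChartSchemeEquiv_symm_apply (I : Fin k → J) {T : Scheme.{u}} (v : {j : J // j ∉ Set.range I} × Fin k → Γ(T, ⊤)) :
    (toChartSchemeEquiv k I).symm v = T.toSpecΓ ≫ Spec.map (chartRingHom k I v) :=
  rfl

/-- **Naturality** of `toChartSchemeEquiv` in `T`: `(f ≫ g)^*(X_p) = f^*(g^*(X_p))`. [cite: StacksProject, Tag 089T] -/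
theorem toChartSchemeEquiv_comp (I : Fin k → J) {T T' : Scheme.{u}} (f : T' ⟶ T) (g : T ⟶ chartScheme k I)
    (p : {j : J // j ∉ Set.range I} × Fin k) :
    toChartSchemeEquiv k I (f ≫ g) p = f.appTop (toChartSchemeEquiv k I g p) :=
  rfl

end Literature.AlgebraicGeometry.Motives.Grassmannian

end
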